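import Literature.MathematicalPhysics.QuantumFieldTheory.Balaban1983to89.Node00.OpsYOfLetters

/-!
# NODE 00 — the GENUINE parallel transporters `U(Γ_{x,x′})` of [B9] (3.40) for the `OpsY` instance (v2 brick P1)

[B9] (3.40) p. 397 measures Hölder quotients of an `𝔤`-valued lattice function COVARIANTLY:
`|R(U(Γ_{x,x′})) λ(x′) − λ(x)| ∕ |x − x′|^α`, *"where `Γ_{x,x′}` is a shortest contour connecting points `x` and `x′`"*, and
`U(Γ) = U(b₁) U(b₂) ⋯ U(bₙ)` is the ordered product of the bond variables along `Γ = b₁ ∪ ⋯ ∪ bₙ` ([B9] (3.3) p. 391; [5] (52)–(55)),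
a bond traversed backwards contributing `U(⟨y, y − e_μ⟩) = U_μ(y − e_μ)⁻¹`.

v1 (`Node00.OpsYOfLetters`) takes the transporters as LETTERS `parS ∕ parB` of a `CovLettersY` record with the `U = 1` clauses
`parS_one ∕ parB_one` as `Prop` fields.  This module CONSTRUCTS them:

* §1 on the torus `Site P 0` of any `Params`: the straight-line transporters `parFwdV U μ n x = U_μ(x) U_μ(x+e_μ) ⋯ U_μ(x+(n−1)e_μ)`,
  `parBwdV U μ n x = U_μ(x−e_μ)⁻¹ ⋯ U_μ(x−n e_μ)⁻¹`; one LEG `taxiLegV` of the canonical taxicab contour in direction `μ` (the shorter way round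
  the circle `ZMod (sitesPerDir 0)`: forward `((x′ − w) μ).val` steps or backward `((w − x′) μ).val` steps); the TAXICAB TRANSPORTER
  `parTaxiV U x x′` (legs `μ = 0, 1, …, d − 1` in this order; a shortest `ℓ¹` contour — `Σ_μ min(forward, backward) = Site.tdist x x′` bonds —
  certified here by its ENDPOINT only, §3);
* §2 the `U = 1` face: `parFwdV_one`, `parBwdV_one`, `parTaxiV_one : parTaxiV 1 x x′ = 1` (PROVED) — the printed clause of Cor. 3.5;
  values in a subgroup `G ≤ 𝔸ˣ` are preserved (`parTaxiV_mem`);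
* §3 the ENDPOINT certificate: the contour built by `parTaxiV` ends at `x′` (`taxiEnd_eq : … = x′`);
* §4 at an index `i : KIdx`: `parBY i : BondParY 𝔸 i` (torus sites = sources of fine bonds), `parSY i : SiteParY 𝔸 i` (box-chart sites,
  through `B6GlobalChartV1.boxEquiv`), their `U = 1` faces, and the UPGRADE `CovLettersY.withTransport 𝔏` replacing a letter family's
  `parS ∕ parB` by the genuine transporters (clauses `parS_one ∕ parB_one` discharged by §2; all other letters kept, `withTransport_Gp` … `rfl`),
  with the inhabitant `covLettersY_flatT x := (covLettersY_flat 𝔸 x).withTransport`.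

HONEST LIMITS.  The choice "legs in the order `μ = 0, …, d−1`, shorter way round each circle (forward on a tie)" is ONE shortest contour;
print fixes *a* shortest contour without saying which (any two choices differ by a plaquette-product conjugation, immaterial for the bounds
(3.43)∕(3.45) under (3.35)).  Nothing here constructs the operator letters G′(U), G(U), C (v2 object `lettersYOfRecord`), nothing continuum,
OS, gap or Clay.

[cite: Balaban1985BackgroundPropagators, (3.3) p.391, (3.40) p.397, Cor. 3.5 p.407; Balaban1985Averaging, (52)–(55) pp.27–28]
-/

namespace Literature.MathematicalPhysics.QuantumFieldTheory.Balaban1983to89.Node00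

open LatticeFieldCalculus (shiftEquiv)
open B6GlobalChartV1 (PV boxEquiv)
open B6KLevelCensusIndexV1 (KIdx)
open B9BackgroundsKLevelV1 (CfgV1)
open B9PinMembersKLevelV1 (MemberY)

noncomputable section

/-! ## §1 Straight-line and taxicab transporters on the torus `Site P 0` -/

section Torus

variable {P : Params} {𝔸 : Type} [Ring 𝔸]

/-- the FORWARD straight-line transporter: `parFwdV U μ n x = U_μ(x) · U_μ(x + e_μ) ⋯ U_μ(x + (n−1)e_μ)` (ordered product along the
contour `x → x + e_μ → ⋯ → x + n e_μ`). [cite: Balaban1985BackgroundPropagators, (3.3) p.391; Balaban1985Averaging, (55) p.28] -/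
def parFwdV (U : CfgV1 P 𝔸) (μ : Fin P.d) : ℕ → Site P 0 → 𝔸ˣ
  | 0, _ => 1
  | n + 1, x => U μ x * parFwdV U μ n (x.shift μ)

/-- the BACKWARD straight-line transporter: `parBwdV U μ n x = U_μ(x − e_μ)⁻¹ · U_μ(x − 2e_μ)⁻¹ ⋯` (the contour `x → x − e_μ → ⋯ → x − n e_μ`,
each bond traversed against its orientation). [cite: Balaban1985BackgroundPropagators, (3.3), (3.8) p.391–392; Balaban1985Averaging, (55) p.28] -/
def parBwdV (U : CfgV1 P 𝔸) (μ : Fin P.d) : ℕ → Site P 0 → 𝔸ˣ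
  | 0, _ => 1
  | n + 1, x => (U μ (x.unshift μ))⁻¹ * parBwdV U μ n (x.unshift μ)

/-- the empty forward contour transports by `1`. [cite: Balaban1985BackgroundPropagators, (3.3) p.391, bookkeeping] -/
@[simp] theorem parFwdV_zero (U : CfgV1 P 𝔸) (μ : Fin P.d) (x : Site P 0) : parFwdV U μ 0 x = 1 := rfl
/-- one more forward bond: `U(Γ) = U_μ(x) · U(Γ′)`. [cite: Balaban1985BackgroundPropagators, (3.3) p.391, bookkeeping] -/
theorem parFwdV_succ (U : CfgV1 P 𝔸) (μ : Fin P.d) (n : ℕ) (x : Site P 0) :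
    parFwdV U μ (n + 1) x = U μ x * parFwdV U μ n (x.shift μ) := rfl
/-- the empty backward contour transports by `1`. [cite: Balaban1985BackgroundPropagators, (3.3) p.391, bookkeeping] -/
@[simp] theorem parBwdV_zero (U : CfgV1 P 𝔸) (μ : Fin P.d) (x : Site P 0) : parBwdV U μ 0 x = 1 := rfl
/-- one more backward bond: `U(Γ) = U_μ(x − e_μ)⁻¹ · U(Γ′)`. [cite: Balaban1985BackgroundPropagators, (3.3), (3.8) pp.391–392, bookkeeping] -/
theorem parBwdV_succ (U : CfgV1 P 𝔸) (μ : Fin P.d) (n : ℕ) (x : Site P 0) :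
    parBwdV U μ (n + 1) x = (U μ (x.unshift μ))⁻¹ * parBwdV U μ n (x.unshift μ) := rfl

/-- one LEG of the taxicab contour, in direction `μ`, from the current endpoint `s.1` to the `μ`-coordinate of `x′`, the shorter way round
(forward `((x′ − w) μ).val` steps if that is `≤` the backward count `((w − x′) μ).val`, else backward), accumulating the transporter in `s.2`.
[cite: Balaban1985BackgroundPropagators, (3.40) p.397 («a shortest contour connecting points x and x′»)] -/
def taxiLegV (U : CfgV1 P 𝔸) (x' : Site P 0) (s : Site P 0 × 𝔸ˣ) (μ : Fin P.d) : Site P 0 × 𝔸ˣ :=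
  if (x' μ - s.1 μ).val ≤ (s.1 μ - x' μ).val then
    ((fun y : Site P 0 => y.shift μ)^[(x' μ - s.1 μ).val] s.1, s.2 * parFwdV U μ (x' μ - s.1 μ).val s.1)
  else ((fun y : Site P 0 => y.unshift μ)^[(s.1 μ - x' μ).val] s.1, s.2 * parBwdV U μ (s.1 μ - x' μ).val s.1)

/-- the legs `μ ∈ l` run in order from the state `s`. [cite: Balaban1985BackgroundPropagators, (3.40) p.397, bookkeeping] -/
def taxiRun (U : CfgV1 P 𝔸) (x' : Site P 0) (l : List (Fin P.d)) (s : Site P 0 × 𝔸ˣ) : Site P 0 × 𝔸ˣ := l.foldl (taxiLegV U x') s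

/-- ★ the TAXICAB TRANSPORTER `U(Γ_{x,x′})`: legs in directions `0, 1, …, d−1` in this order, each the shorter way round.
[cite: Balaban1985BackgroundPropagators, (3.3) p.391, (3.40) p.397; Balaban1985Averaging, (52)–(55) pp.27–28] -/
def parTaxiV (U : CfgV1 P 𝔸) (x x' : Site P 0) : 𝔸ˣ := (taxiRun U x' (List.finRange P.d) (x, 1)).2

/-- the endpoint of the taxicab contour from `x` towards `x′`. [cite: Balaban1985BackgroundPropagators, (3.40) p.397, bookkeeping] -/
def taxiEnd (U : CfgV1 P 𝔸) (x x' : Site P 0) : Site P 0 := (taxiRun U x' (List.finRange P.d) (x, 1)).1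

/-! ## §2 The `U = 1` face and values in a subgroup -/

/-- `parFwdV 1 = 1`. [cite: Balaban1985BackgroundPropagators, Cor. 3.5 p.407 (U = 1)] -/
@[simp] theorem parFwdV_one (μ : Fin P.d) (n : ℕ) (x : Site P 0) : parFwdV (fun _ _ => 1 : CfgV1 P 𝔸) μ n x = 1 := by
  induction n generalizing x with
  | zero => rfl
  | succ n ih => rw [parFwdV_succ, ih, mul_one]

/-- `parBwdV 1 = 1`. [cite: Balaban1985BackgroundPropagators, Cor. 3.5 p.407 (U = 1)] -/
@[simp] theorem parBwdV_one (μ : Fin P.d) (n : ℕ) (x : Site P 0) : parBwdV (fun _ _ => 1 : CfgV1 P 𝔸) μ n x = 1 := by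
  induction n generalizing x with
  | zero => rfl
  | succ n ih => rw [parBwdV_succ, ih, inv_one, mul_one]

/-- a leg at `U = 1` does not change the accumulated transporter. [cite: Balaban1985BackgroundPropagators, Cor. 3.5 p.407 (U = 1), bookkeeping] -/
theorem taxiLegV_one_snd (x' : Site P 0) (s : Site P 0 × 𝔸ˣ) (μ : Fin P.d) : (taxiLegV (fun _ _ => 1 : CfgV1 P 𝔸) x' s μ).2 = s.2 := by
  unfold taxiLegV
  split_ifs <;> simp

/-- a run at `U = 1` does not change the accumulated transporter. [cite: Balaban1985BackgroundPropagators, Cor. 3.5 p.407 (U = 1), bookkeeping] -/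
theorem taxiRun_one_snd (x' : Site P 0) (l : List (Fin P.d)) (s : Site P 0 × 𝔸ˣ) :
    (taxiRun (fun _ _ => 1 : CfgV1 P 𝔸) x' l s).2 = s.2 := by
  induction l generalizing s with
  | nil => rfl
  | cons μ l ih => simp only [taxiRun, List.foldl_cons] at ih ⊢; rw [ih, taxiLegV_one_snd]

/-- ★ the printed `U = 1` clause: `U(Γ_{x,x′}) = 1` at the trivial configuration. [cite: Balaban1985BackgroundPropagators, Cor. 3.5 p.407 (U = 1)] -/
@[simp] theorem parTaxiV_one (x x' : Site P 0) : parTaxiV (fun _ _ => 1 : CfgV1 P 𝔸) x x' = 1 := by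
  unfold parTaxiV; rw [taxiRun_one_snd]

/-- forward transporters of a `G`-valued configuration are `G`-valued. [cite: Balaban1985BackgroundPropagators, (3.3) p.391, bookkeeping] -/
theorem parFwdV_mem {G : Subgroup 𝔸ˣ} {U : CfgV1 P 𝔸} (hU : ∀ μ x, U μ x ∈ G) (μ : Fin P.d) (n : ℕ) (x : Site P 0) : parFwdV U μ n x ∈ G := by
  induction n generalizing x with
  | zero => exact G.one_mem
  | succ n ih => rw [parFwdV_succ]; exact G.mul_mem (hU μ x) (ih _)

/-- backward transporters of a `G`-valued configuration are `G`-valued. [cite: Balaban1985BackgroundPropagators, (3.3) p.391, bookkeeping] -/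
theorem parBwdV_mem {G : Subgroup 𝔸ˣ} {U : CfgV1 P 𝔸} (hU : ∀ μ x, U μ x ∈ G) (μ : Fin P.d) (n : ℕ) (x : Site P 0) : parBwdV U μ n x ∈ G := by
  induction n generalizing x with
  | zero => exact G.one_mem
  | succ n ih => rw [parBwdV_succ]; exact G.mul_mem (G.inv_mem (hU μ _)) (ih _)

/-- a leg keeps the accumulated transporter in `G`. [cite: Balaban1985BackgroundPropagators, (3.3) p.391, bookkeeping] -/
theorem taxiLegV_mem {G : Subgroup 𝔸ˣ} {U : CfgV1 P 𝔸} (hU : ∀ μ x, U μ x ∈ G) (x' : Site P 0) {s : Site P 0 × 𝔸ˣ} (hs : s.2 ∈ G) (μ : Fin P.d) :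
    (taxiLegV U x' s μ).2 ∈ G := by
  unfold taxiLegV
  split_ifs
  · exact G.mul_mem hs (parFwdV_mem hU μ _ _)
  · exact G.mul_mem hs (parBwdV_mem hU μ _ _)

/-- a run keeps the accumulated transporter in `G`. [cite: Balaban1985BackgroundPropagators, (3.3) p.391, bookkeeping] -/
theorem taxiRun_mem {G : Subgroup 𝔸ˣ} {U : CfgV1 P 𝔸} (hU : ∀ μ x, U μ x ∈ G) (x' : Site P 0) (l : List (Fin P.d)) {s : Site P 0 × 𝔸ˣ}
    (hs : s.2 ∈ G) : (taxiRun U x' l s).2 ∈ G := by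
  induction l generalizing s with
  | nil => exact hs
  | cons μ l ih => simp only [taxiRun, List.foldl_cons] at ih ⊢; exact ih (taxiLegV_mem hU x' hs μ)

/-- ★ `U(Γ_{x,x′}) ∈ G` for a `G`-valued configuration (e.g. `G = SU(N)`: the transporters are special unitary, so `R(U(Γ))` is an isometry
of `𝔤`). [cite: Balaban1985BackgroundPropagators, (3.3) p.391, (3.40) p.397] -/
theorem parTaxiV_mem {G : Subgroup 𝔸ˣ} {U : CfgV1 P 𝔸} (hU : ∀ μ x, U μ x ∈ G) (x x' : Site P 0) : parTaxiV U x x' ∈ G :=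
  taxiRun_mem hU x' _ G.one_mem

/-! ## §3 The endpoint certificate: the contour connects `x` to `x′` -/

/-- `n` forward steps in direction `μ` add `n` to the `μ`-coordinate and fix the others. [cite: Balaban1985BackgroundPropagators, (3.3) p.391, bookkeeping] -/
theorem iterate_shift_apply (μ : Fin P.d) (n : ℕ) (x : Site P 0) (ν : Fin P.d) :
    ((fun y : Site P 0 => y.shift μ)^[n] x) ν = if ν = μ then x ν + n else x ν := by
  induction n generalizing x with
  | zero => simp
  | succ n ih =>
    rw [Function.iterate_succ_apply, ih]
    by_cases h : ν = μ
    · subst h; rw [if_pos rfl, if_pos rfl]; simp only [Site.shift, Function.update_self, Nat.cast_succ]; ring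
    · simp [Site.shift, h]

/-- `n` backward steps in direction `μ` subtract `n` from the `μ`-coordinate and fix the others. [cite: Balaban1985BackgroundPropagators, (3.3) p.391, bookkeeping] -/
theorem iterate_unshift_apply (μ : Fin P.d) (n : ℕ) (x : Site P 0) (ν : Fin P.d) :
    ((fun y : Site P 0 => y.unshift μ)^[n] x) ν = if ν = μ then x ν - n else x ν := by
  induction n generalizing x with
  | zero => simp
  | succ n ih =>
    rw [Function.iterate_succ_apply, ih]
    by_cases h : ν = μ
    · subst h; rw [if_pos rfl, if_pos rfl]; simp only [Site.unshift, Function.update_self, Nat.cast_succ]; ring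
    · simp [Site.unshift, h]

/-- after the leg in direction `μ`, the `μ`-coordinate is that of `x′` and the other coordinates are unchanged.
[cite: Balaban1985BackgroundPropagators, (3.40) p.397, bookkeeping] -/
theorem taxiLegV_fst_apply (U : CfgV1 P 𝔸) (x' : Site P 0) (s : Site P 0 × 𝔸ˣ) (μ ν : Fin P.d) :
    (taxiLegV U x' s μ).1 ν = if ν = μ then x' ν else s.1 ν := by
  unfold taxiLegV
  split_ifs with h hν hν
  · subst hν; simp [iterate_shift_apply]
  · simp only [iterate_shift_apply, if_neg hν]
  · subst hν; simp [iterate_unshift_apply]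
  · simp only [iterate_unshift_apply, if_neg hν]

/-- after running the legs `l`, every coordinate in `l` is that of `x′` and the others are those of the start.
[cite: Balaban1985BackgroundPropagators, (3.40) p.397, bookkeeping] -/
theorem taxiRun_fst_apply (U : CfgV1 P 𝔸) (x' : Site P 0) (l : List (Fin P.d)) (s : Site P 0 × 𝔸ˣ) (ν : Fin P.d) :
    (taxiRun U x' l s).1 ν = if ν ∈ l then x' ν else s.1 ν := by
  induction l generalizing s with
  | nil => simp [taxiRun]
  | cons μ l ih =>
    simp only [taxiRun, List.foldl_cons] at ih ⊢
    rw [ih, taxiLegV_fst_apply]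
    by_cases h1 : ν ∈ l
    · simp [h1]
    · by_cases h2 : ν = μ
      · subst h2; simp [h1]
      · simp [h1, h2]

/-- ★ the taxicab contour from `x` towards `x′` ENDS AT `x′`. [cite: Balaban1985BackgroundPropagators, (3.40) p.397 («contour connecting points x and x′»)] -/
theorem taxiEnd_eq (U : CfgV1 P 𝔸) (x x' : Site P 0) : taxiEnd U x x' = x' := by
  funext ν
  unfold taxiEnd
  rw [taxiRun_fst_apply, if_pos (List.mem_finRange ν)]

/-- the trivial contour: `U(Γ_{x,x}) = 1`. [cite: Balaban1985BackgroundPropagators, (3.40) p.397, bookkeeping] -/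
theorem taxiLegV_self (U : CfgV1 P 𝔸) (x : Site P 0) (s : Site P 0 × 𝔸ˣ) (μ : Fin P.d) (h : s.1 μ = x μ) : taxiLegV U x s μ = s := by
  unfold taxiLegV
  simp [h]

/-- the trivial contour: `U(Γ_{x,x}) = 1`. [cite: Balaban1985BackgroundPropagators, (3.40) p.397, bookkeeping] -/
theorem parTaxiV_self (U : CfgV1 P 𝔸) (x : Site P 0) : parTaxiV U x x = 1 := by
  suffices h : ∀ l : List (Fin P.d), taxiRun U x l (x, 1) = (x, 1) by unfold parTaxiV; rw [h]
  intro l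
  induction l with
  | nil => rfl
  | cons μ l ih =>
    have h1 : taxiLegV U x (x, 1) μ = (x, 1) := taxiLegV_self U x _ μ rfl
    simp only [taxiRun, List.foldl_cons] at ih ⊢
    rw [h1]; exact ih

end Torus

/-! ## §4 At an index: the letters `parS ∕ parB` made genuine -/

section Index

variable {d ℓ : ℕ} {hd : 1 ≤ d + 1} {hL : Odd (ℓ + 1) ∧ 1 < ℓ + 1} {b₀ b₁ : ℝ} {Mstar : ℕ}
variable {𝔸 : Type} [NormedRing 𝔸] [NormedAlgebra ℂ 𝔸] [CompleteSpace 𝔸]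

/-- ★ the genuine BOND-sector transporter letter: `U(Γ_{s,s′})` between torus sites (sources of fine bonds).
[cite: Balaban1985BackgroundPropagators, (3.40) p.397] -/
def parBY (i : KIdx d ℓ hd hL b₀ b₁) : BondParY 𝔸 i := fun U s s' => parTaxiV U s s'

/-- ★ the genuine SITE-sector transporter letter: `U(Γ_{z,z′})` between box-chart sites, through the chart `boxEquiv`.
[cite: Balaban1985BackgroundPropagators, (3.40) p.397, dictionary (chart `B6GlobalChartV1.boxEquiv`)] -/
def parSY (i : KIdx d ℓ hd hL b₀ b₁) : SiteParY 𝔸 i := fun U z z' => parTaxiV U ((boxEquiv i.hN).symm z) ((boxEquiv i.hN).symm z')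

/-- `U = 1` face of `parBY`. [cite: Balaban1985BackgroundPropagators, Cor. 3.5 p.407 (U = 1)] -/
@[simp] theorem parBY_one (i : KIdx d ℓ hd hL b₀ b₁) (s s' : Site (PV d ℓ i.m i.K hd hL) 0) : parBY (𝔸 := 𝔸) i (fun _ _ => 1) s s' = 1 :=
  parTaxiV_one s s'

/-- `U = 1` face of `parSY`. [cite: Balaban1985BackgroundPropagators, Cor. 3.5 p.407 (U = 1)] -/
@[simp] theorem parSY_one (i : KIdx d ℓ hd hL b₀ b₁) (z z' : SiteY i) : parSY (𝔸 := 𝔸) i (fun _ _ => 1) z z' = 1 :=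
  parTaxiV_one _ _

/-- `parBY` of a `G`-valued configuration is `G`-valued. [cite: Balaban1985BackgroundPropagators, (3.3) p.391, bookkeeping] -/
theorem parBY_mem (i : KIdx d ℓ hd hL b₀ b₁) {G : Subgroup 𝔸ˣ} {U : CfgY 𝔸 i} (hU : ∀ μ x, U μ x ∈ G) (s s' : Site (PV d ℓ i.m i.K hd hL) 0) :
    parBY i U s s' ∈ G :=
  parTaxiV_mem hU s s'

/-- `parSY` of a `G`-valued configuration is `G`-valued. [cite: Balaban1985BackgroundPropagators, (3.3) p.391, bookkeeping] -/
theorem parSY_mem (i : KIdx d ℓ hd hL b₀ b₁) {G : Subgroup 𝔸ˣ} {U : CfgY 𝔸 i} (hU : ∀ μ x, U μ x ∈ G) (z z' : SiteY i) : parSY i U z z' ∈ G :=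
  parTaxiV_mem hU _ _

variable (𝔸)

/-- ★ the UPGRADE of a letter family: its transporters replaced by the genuine `parSY ∕ parBY` (the clauses `parS_one ∕ parB_one` are now
theorems), every other letter kept. [cite: Balaban1985BackgroundPropagators, (3.40) p.397, Cor. 3.5 p.407] -/
def CovLettersY.withTransport {x : MemberY d ℓ hd hL b₀ b₁ Mstar} (𝔏 : CovLettersY 𝔸 x) : CovLettersY 𝔸 x :=
  { 𝔏 with
    parS := parSY x.toKIdx
    parB := parBY x.toKIdx
    parS_one := fun z z' => parSY_one x.toKIdx z z'
    parB_one := fun s s' => parBY_one x.toKIdx s s' }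

variable {𝔸}
variable {x : MemberY d ℓ hd hL b₀ b₁ Mstar} (𝔏 : CovLettersY 𝔸 x)

/-- the upgraded site transporter is `parSY`. [cite: Balaban1985BackgroundPropagators, (3.40) p.397, bookkeeping] -/
@[simp] theorem CovLettersY.withTransport_parS : (𝔏.withTransport 𝔸).parS = parSY x.toKIdx := rfl
/-- the upgraded bond transporter is `parBY`. [cite: Balaban1985BackgroundPropagators, (3.40) p.397, bookkeeping] -/
@[simp] theorem CovLettersY.withTransport_parB : (𝔏.withTransport 𝔸).parB = parBY x.toKIdx := rfl
/-- the upgrade keeps G′(U). [cite: Balaban1985BackgroundPropagators, (3.25) p.395, bookkeeping] -/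
@[simp] theorem CovLettersY.withTransport_Gp : (𝔏.withTransport 𝔸).Gp = 𝔏.Gp := rfl
/-- the upgrade keeps G(U). [cite: Balaban1985BackgroundPropagators, (3.27) p.395, bookkeeping] -/
@[simp] theorem CovLettersY.withTransport_GA : (𝔏.withTransport 𝔸).GA = 𝔏.GA := rfl
/-- the upgrade keeps C. [cite: Balaban1985BackgroundPropagators, (3.48) p.398, bookkeeping] -/
@[simp] theorem CovLettersY.withTransport_C : (𝔏.withTransport 𝔸).C = 𝔏.C := rfl
/-- the upgrade keeps G_D. [cite: Balaban1985BackgroundPropagators, (3.126) p.421, bookkeeping] -/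
@[simp] theorem CovLettersY.withTransport_GD : (𝔏.withTransport 𝔸).GD = 𝔏.GD := rfl
/-- the upgrade keeps G₁. [cite: Balaban1985BackgroundPropagators, (3.127) p.421, bookkeeping] -/
@[simp] theorem CovLettersY.withTransport_G₁ : (𝔏.withTransport 𝔸).G₁ = 𝔏.G₁ := rfl
/-- the upgrade keeps the G-difference letter. [cite: Balaban1985BackgroundPropagators, (3.128) p.421, bookkeeping] -/
@[simp] theorem CovLettersY.withTransport_GG : (𝔏.withTransport 𝔸).GG = 𝔏.GG := rfl
/-- the upgrade keeps the kernel-difference letter. [cite: Balaban1985BackgroundPropagators, (3.132) p.422, bookkeeping] -/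
@[simp] theorem CovLettersY.withTransport_Kdiff : (𝔏.withTransport 𝔸).Kdiff = 𝔏.Kdiff := rfl
/-- the upgrade keeps H. [cite: Balaban1985BackgroundPropagators, (3.129) p.421, bookkeeping] -/
@[simp] theorem CovLettersY.withTransport_H : (𝔏.withTransport 𝔸).H = 𝔏.H := rfl
/-- the upgrade keeps H₁. [cite: Balaban1985BackgroundPropagators, (3.130) p.421, bookkeeping] -/
@[simp] theorem CovLettersY.withTransport_H₁ : (𝔏.withTransport 𝔸).H₁ = 𝔏.H₁ := rfl
/-- the upgrade keeps C^{(k)}. [cite: Balaban1985BackgroundPropagators, (3.187) p.432, bookkeeping] -/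
@[simp] theorem CovLettersY.withTransport_Ck : (𝔏.withTransport 𝔸).Ck = 𝔏.Ck := rfl
/-- the upgrade keeps (Q G Q*)⁻¹. [cite: Balaban1985BackgroundPropagators, (3.131) p.422, bookkeeping] -/
@[simp] theorem CovLettersY.withTransport_QGQinv : (𝔏.withTransport 𝔸).QGQinv = 𝔏.QGQinv := rfl
/-- the upgrade keeps (Q G₁ Q*)⁻¹. [cite: Balaban1985BackgroundPropagators, (3.131) p.422, bookkeeping] -/
@[simp] theorem CovLettersY.withTransport_QG1Qinv : (𝔏.withTransport 𝔸).QG1Qinv = 𝔏.QG1Qinv := rfl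
/-- the upgrade keeps the (3.49) letter. [cite: Balaban1985BackgroundPropagators, (3.49) p.399, bookkeeping] -/
@[simp] theorem CovLettersY.withTransport_P349 : (𝔏.withTransport 𝔸).P349 = 𝔏.P349 := rfl

/-- the upgrade is idempotent. [cite: Balaban1985BackgroundPropagators, (3.40) p.397, bookkeeping] -/
theorem CovLettersY.withTransport_withTransport : (𝔏.withTransport 𝔸).withTransport 𝔸 = 𝔏.withTransport 𝔸 := rfl

variable (𝔸) (x)

/-- the flat letter family WITH GENUINE TRANSPORT (an inhabitant whose `parS ∕ parB` are `U(Γ_{x,x′})`).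
[cite: Balaban1985BackgroundPropagators, (3.40) p.397, Cor. 3.5 p.407, dictionary] -/
def covLettersY_flatT : CovLettersY 𝔸 x := (covLettersY_flat 𝔸 x).withTransport 𝔸

end Index

end

end Literature.MathematicalPhysics.QuantumFieldTheory.Balaban1983to89.Node00
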